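/-
Copyright (c) 2026 the pub-hodgecm-mathlib formalisation cell (harness21).  Prover seat hodgecm-mathlib-K2E3-p04 (g2), Track B ∕ K2-LIT
(build stream 29), h413 = `stmt-HodgeConjecture-24833`, line `K2_E3_EllipticInputs`, unit U4 «Keys» — road I («Keys' own road»: the rank-one intertwining
integral), brick I-3e «THE CLOSED FORM OF THE `c`-FUNCTION SERIES».  2026-09-04.
-/
import Summits.HodgeConjecture.HodgeConjecture.Theorems.K2E3SphericalCFunctionShellExpansion   -- ★ p855911 (this base, g2): shell partition, shell values, `∫_N f(w₀u)dμ = μ(B₁)f(1) + Σ'_n μ(S_{n+1})·const_n·f(1)`, ★ I-2a docked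
import Summits.HodgeConjecture.HodgeConjecture.Theorems.K2E3HeightBallVolumeScaling           -- ★ p855644 (this base, g0): `μ{m ≤ A(‖α‖⁻²)^k} = (‖α‖²)⁻ᵏ μ{m ≤ A}`, `measure_heightBall_lt_top`
import Mathlib.Analysis.SpecificLimits.Normed
import HarnessLib

/-!
# h413 ∕ Track B «K2-LIT», unit U4 «Keys», road I brick I-3e: THE CLOSED FORM OF HARISH-CHANDRA'S `c`-FUNCTION SERIES on `U(Φ₃)(L⁺_v)` —
# `c_w(χ) = μ(B₁) + χ₂(−1)·(V₁ t + V₂ t²)∕(1 − z²)`, `z = χ₁(ϖ)`, `t = z‖ϖ‖ = z∕q_w`, `V_k = μ{‖u₀₂‖ = q_w^k}` (`k = 1, 2`), for `|z| < 1`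
# [Casselman1995 §6.4; Rogawski1990 §4.5 p. 45; Keys1984 §4]

Cell `pub/hodgecm-mathlib`, crux H413 = `stmt-HodgeConjecture-24833` (lane `--supports … --as helper`), route HCCMUnconditional; dealer K2E3-plan (g1) («Road I files stay
`--supports 24833 --as helper`», 2026-09-03T23:02Z); file 4 of MEMO `K2/K2E3-p04/g0/MEMO-ROAD-I-intertwining-integral.K2E3-p04-g0.md` §3 (§2 (I-3) there).  THEOREMS ONLY
(0 def ∕ 0 instance ∕ 0 notation ∕ 0 sorry); ★ + Mathlib imports.  ★ p855911 wrote `c_w(χ) = ∫_N f_K(w₀ n) dμ` as `μ(B₁) f(1) + Σ'_n μ(S_{n+1}) (z‖ϖ‖)^{n+1} χ₂(−1) f(1)`;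
here the EVEN-STEP RECURSION of the shell volumes `μ(S_{k+2}) = q_w² μ(S_k)` (★ `measure_heightBall_scaling` at `α = ϖ`, and `S_k = B_{q^k} ∖ B_{q^{k−1}}`) makes the series
two interleaved geometric series of ratio `z²`, and sums it.  What remains between road I and Macdonald's formula for the quasi-split `U(3)` ([Casselman1995, §6.4];
[Rogawski1990, §4.5]) is the pair of ratios `V₁ : V₂ : μ(B₁)` by ramification type (brick I-3d `K2E3HeisenbergShellVolumes*`).

THE MATHEMATICS.  Notation of ★ p855911: `v` non-split, `R = Π_{w∣v} L_w`, `ϖ` a uniformiser unit, `a = ‖ϖ‖ = q_w⁻¹ ∈ (0, 1)`, `N = N(L⁺_v)`, height `m(u) = Π_w |(u₀₂)_w|_w`,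
`B_T = {m ≤ T}`, shells `S_{n+1} = {m = a^{−(n+1)}}` (`n : ℕ`), `μ` a Haar measure on `N`, `χ₁` unramified, `z = χ₁(ϖ)`, `f` a `K_v`-fixed vector of ★ `cmPrincipalSeries L 3 v (χ₁, χ₂)`.
* §1 (generic, Mathlib-only) `hasSum_of_succ_succ_eq_mul` ∕ `tsum_eq_of_succ_succ_eq_mul`: a complex sequence with `a_{n+2} = r a_n`, `|r| < 1`, has sum `(a₀ + a₁)(1 − r)⁻¹`
  (even and odd subsequences are geometric; Mathlib `hasSum_geometric_of_norm_lt_one`, `HasSum.even_add_odd`).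
* §2 shell geometry: `measure_heightBall_succ_succ` — `μ(B_{a^{−(n+2)}}) = a⁻² μ(B_{a^{−n}})` (★ `measure_heightBall_scaling`, `α = ϖ`, `k = 1`); `shell_eq_ball_diff` —
  `S_{n+1} = B_{a^{−(n+1)}} ∖ B_{a^{−n}}` (the values of `m` lie in `{0} ∪ a^ℤ`, ★ `height_le_one_or_eq_inv_pow`); **`measure_shell_succ_succ`** ∕ `measureReal_shell_succ_succ` —
  `μ(S_{n+3}) = a⁻² μ(S_{n+1})` (Mathlib `measure_sdiff`, balls of finite measure ★ `measure_heightBall_lt_top`).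
* §3 **`tsum_shellSeries_eq`** — the shell series of ★ p855911 has `term_{n+2} = z² term_n` (`a⁻² · (z a)² = z²`), hence equals `(term₀ + term₁)(1 − z²)⁻¹` for `|z| < 1`.
* §4 **`integral_cellFun_eq_closedForm`** — for `χ₂` continuous, `χ₁` UNRAMIFIED with `|χ₁| = ‖·‖^s`, `s > 0` (so `|z| = a^s < 1`), `μ` Haar, `f` `K_v`-fixed:
  `∫_N f(w₀ u) dμ = (μ(B₁) + χ₂(−1)·(μ(S₁)·(z a) + μ(S₂)·(z a)²)·(1 − z²)⁻¹) · f(1)`  (★ `integral_cellFun_eq_shellExpansion_of_modulus` + §3).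
* §5 **`exists_intertwiningIntegral_sphericalVector_eq_closedForm_smul`** — docked on ★ I-2a ∕ ★ p855911 §5: the intertwining integral `J ≠ 0` of ★ RUNG 3 has
  `J f_K = (μ(B₁) + χ₂(−1)(V₁ z a + V₂ z² a²)(1 − z²)⁻¹) f_K(1) • f'_K` — HARISH-CHANDRA's `c_w(χ)` IN CLOSED FORM up to the two local constants `V₁∕μ(B₁)`, `V₂∕μ(B₁)`;
  its only possible poles on the unramified line are at `z² = 1` (`wχ = χ`, the irregular line of U4-c), as in Macdonald's formula.

HONEST LABEL.  HC_CM is proved only modulo the 7 printed citations (2 remaining named inputs: hLiu418 = `stmt-HodgeConjecture-24832`, h413 = `stmt-HodgeConjecture-24833`) until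
rung 0 closes; count-neutral infrastructure of road I (no socket is paid by this file).

## References
* [Casselman1995] W. Casselman, *Introduction to the theory of admissible representations of `p`-adic reductive groups* (1995), §6.4 pp. 62–64 (`c_w(χ)` as a sum of geometric series).
* [Rogawski1990] J. D. Rogawski, *Automorphic Representations of Unitary Groups in Three Variables* (1990), §4.5 p. 45, §12.2 p. 173.
* [Keys1984] D. Keys, *Principal series representations of special unitary groups over local fields*, Compositio Math. 51 (1984), §4 (Plancherel measure ∕ `c`-functions of `SU(2,1)`).
* [WeilBNT1967] A. Weil, *Basic Number Theory* (1967), Ch. I §4, Ch. II §5 Prop. 12 (module and scaling of Haar measures).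
* [TateThesis1967] J. Tate, *Fourier analysis in number fields and Hecke's zeta-functions*, in Cassels–Fröhlich (1967), §2.4.
-/

set_option autoImplicit false
-- the mandated namespace repeats the single-problem summit's segment (`HodgeConjecture.HodgeConjecture`)
set_option linter.dupNamespace false

noncomputable section

open NumberField IsDedekindDomain MeasureTheory
open scoped Matrix NNReal ENNReal

open Literature.NumberTheory Literature.NumberTheory.Automorphic Literature.NumberTheory.Automorphic.UnitaryGroup
open Literature.NumberTheory.GaloisRepresentations Literature.NumberTheory.GaloisRepresentations.IsNonarchimedeanLocalField

namespace Summit.HodgeConjecture.HodgeConjecture.Cruxes.H413.K2E3SphericalCFunctionClosedForm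

/-! ## §1 Generic: a two-step geometric series -/

/-- **A two-step geometric series**: if `a_{n+2} = r · a_n` for all `n` and `|r| < 1` then `Σ a_n` HAS SUM `(a₀ + a₁)(1 − r)⁻¹` — the even terms are `r^k a₀`, the odd ones `r^k a₁`
(Mathlib `hasSum_geometric_of_norm_lt_one`, `HasSum.even_add_odd`). [cite: Casselman1995, §6.4 p. 63] [cite: TateThesis1967, §2.4] -/
theorem hasSum_of_succ_succ_eq_mul {a : ℕ → ℂ} {r : ℂ} (hr : ‖r‖ < 1) (ha : ∀ n, a (n + 2) = r * a n) :
    HasSum a ((a 0 + a 1) * (1 - r)⁻¹) := by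
  have heven : ∀ k, a (2 * k) = r ^ k * a 0 := by
    intro k
    induction k with
    | zero => rw [mul_zero, pow_zero, one_mul]
    | succ k ih => rw [show 2 * (k + 1) = 2 * k + 2 by ring, ha, ih, pow_succ]; ring
  have hodd : ∀ k, a (2 * k + 1) = r ^ k * a 1 := by
    intro k
    induction k with
    | zero => rw [mul_zero, zero_add, pow_zero, one_mul]
    | succ k ih => rw [show 2 * (k + 1) + 1 = (2 * k + 1) + 2 by ring, ha, ih, pow_succ]; ring
  have hg := hasSum_geometric_of_norm_lt_one hr
  have he : HasSum (fun k => a (2 * k)) ((1 - r)⁻¹ * a 0) := by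
    simp_rw [heven]; exact hg.mul_right (a 0)
  have ho : HasSum (fun k => a (2 * k + 1)) ((1 - r)⁻¹ * a 1) := by
    simp_rw [hodd]; exact hg.mul_right (a 1)
  have h := he.even_add_odd ho
  convert h using 1
  ring

/-- `Σ' a_n = (a₀ + a₁)(1 − r)⁻¹` under `a_{n+2} = r a_n`, `|r| < 1` (the `tsum` form of `hasSum_of_succ_succ_eq_mul`). [cite: Casselman1995, §6.4 p. 63] -/
theorem tsum_eq_of_succ_succ_eq_mul {a : ℕ → ℂ} {r : ℂ} (hr : ‖r‖ < 1) (ha : ∀ n, a (n + 2) = r * a n) :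
    ∑' n, a n = (a 0 + a 1) * (1 - r)⁻¹ :=
  (hasSum_of_succ_succ_eq_mul hr ha).tsum_eq

/-! ## §2 Shell geometry on `N(L⁺_v)`: `S_{n+1} = B_{a^{−(n+1)}} ∖ B_{a^{−n}}` and `μ(S_{n+3}) = a⁻² μ(S_{n+1})` -/

variable (L : Type) [Field L] [NumberField L] [IsCMField L] (v : HeightOneSpectrum (𝓞 ↥(maximalRealSubfield L)))

set_option synthInstance.maxHeartbeats 400000 in
set_option maxHeartbeats 3200000 in
-- the matrix-group carrier of `N(L⁺_v)` (class of ★ `K2E3HeightBallVolumeScaling.measure_heightBall_scaling`)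
/-- **`μ(B_{a^{−(n+2)}}) = a⁻² · μ(B_{a^{−n}})`** (`a = ‖ϖ‖`, any unit `ϖ`, any Haar `μ` on `N(L⁺_v)`, any finite `v`): ★ `measure_heightBall_scaling` at `α = ϖ`, `A = a^{−n}`, `k = 1`.
[cite: WeilBNT1967, Ch. II §5 Prop. 12] [cite: Casselman1995, §6.4 p. 63] -/
theorem measure_heightBall_succ_succ (ϖ : (LocalRing L v)ˣ)
    [MeasurableSpace ↥(cmBorelTriple L 3 v).N] [BorelSpace ↥(cmBorelTriple L 3 v).N] (μ : Measure ↥(cmBorelTriple L 3 v).N) [μ.IsHaarMeasure] (n : ℕ) :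
    μ {u : ↥(cmBorelTriple L 3 v).N | (((∏ w' : PlacesOver L v, normAbs (w'.1.adicCompletion L) ((((((u : ↥(unitaryGroupOfForm (conjLocal L (IsCMField.complexConj L) v) (cmLocalForm L 3 v)))) : GL (Fin 3) (LocalRing L v)) : Matrix (Fin 3) (Fin 3) (LocalRing L v)) 0 2) w')) : ℝ≥0) : ℝ) ≤ (((unitModulusChar (LocalRing L v) ϖ : ℝ≥0) : ℝ)⁻¹) ^ (n + 2)} =
      (ENNReal.ofNNReal (unitModulusChar (LocalRing L v) ϖ * unitModulusChar (LocalRing L v) ϖ))⁻¹ * μ {u : ↥(cmBorelTriple L 3 v).N | (((∏ w' : PlacesOver L v, normAbs (w'.1.adicCompletion L) ((((((u : ↥(unitaryGroupOfForm (conjLocal L (IsCMField.complexConj L) v) (cmLocalForm L 3 v)))) : GL (Fin 3) (LocalRing L v)) : Matrix (Fin 3) (Fin 3) (LocalRing L v)) 0 2) w')) : ℝ≥0) : ℝ) ≤ (((unitModulusChar (LocalRing L v) ϖ : ℝ≥0) : ℝ)⁻¹) ^ n} := by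
  have h := K2E3HeightBallVolumeScaling.measure_heightBall_scaling L v ϖ μ ((((unitModulusChar (LocalRing L v) ϖ : ℝ≥0) : ℝ)⁻¹) ^ n) 1
  have he : (((unitModulusChar (LocalRing L v) ϖ : ℝ≥0) : ℝ)⁻¹) ^ n * ((((unitModulusChar (LocalRing L v) ϖ : ℝ≥0) : ℝ) * ((unitModulusChar (LocalRing L v) ϖ : ℝ≥0) : ℝ))⁻¹) ^ 1 = (((unitModulusChar (LocalRing L v) ϖ : ℝ≥0) : ℝ)⁻¹) ^ (n + 2) := by
    rw [pow_one, mul_inv, pow_add, pow_two]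
  rw [he, pow_one] at h
  exact h

set_option synthInstance.maxHeartbeats 400000 in
set_option maxHeartbeats 3200000 in
-- the matrix-group carrier of `N(L⁺_v)` (class of ★ `K2E3SphericalCFunctionShellExpansion.height_le_one_or_eq_inv_pow`)
/-- **`S_{n+1} = B_{a^{−(n+1)}} ∖ B_{a^{−n}}`** (`v` non-split, `ϖ` a uniformiser unit, `a = ‖ϖ‖ < 1`): the heights on `N` lie in `{0} ∪ a^ℤ` (★ `height_le_one_or_eq_inv_pow`), so
`m(u) ≤ a^{−(n+1)} ∧ ¬ m(u) ≤ a^{−n}` iff `m(u) = a^{−(n+1)}`. [cite: Casselman1995, §6.4 p. 63] [cite: WeilBNT1967, Ch. I §4] -/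
theorem shell_eq_ball_diff (hns : ∀ w : PlacesOver L v, IsCMField.complexConj L • w.1 = w.1)
    (ϖ : (LocalRing L v)ˣ) (hϖ : ∀ w : PlacesOver L v, Valued.v ((ϖ : LocalRing L v) w) = WithZero.exp (-1 : ℤ)) (n : ℕ) :
    {u : ↥(cmBorelTriple L 3 v).N | (((∏ w' : PlacesOver L v, normAbs (w'.1.adicCompletion L) ((((((u : ↥(unitaryGroupOfForm (conjLocal L (IsCMField.complexConj L) v) (cmLocalForm L 3 v)))) : GL (Fin 3) (LocalRing L v)) : Matrix (Fin 3) (Fin 3) (LocalRing L v)) 0 2) w')) : ℝ≥0) : ℝ) = (((unitModulusChar (LocalRing L v) ϖ : ℝ≥0) : ℝ)⁻¹) ^ (n + 1)} =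
      {u : ↥(cmBorelTriple L 3 v).N | (((∏ w' : PlacesOver L v, normAbs (w'.1.adicCompletion L) ((((((u : ↥(unitaryGroupOfForm (conjLocal L (IsCMField.complexConj L) v) (cmLocalForm L 3 v)))) : GL (Fin 3) (LocalRing L v)) : Matrix (Fin 3) (Fin 3) (LocalRing L v)) 0 2) w')) : ℝ≥0) : ℝ) ≤ (((unitModulusChar (LocalRing L v) ϖ : ℝ≥0) : ℝ)⁻¹) ^ (n + 1)} \ {u : ↥(cmBorelTriple L 3 v).N | (((∏ w' : PlacesOver L v, normAbs (w'.1.adicCompletion L) ((((((u : ↥(unitaryGroupOfForm (conjLocal L (IsCMField.complexConj L) v) (cmLocalForm L 3 v)))) : GL (Fin 3) (LocalRing L v)) : Matrix (Fin 3) (Fin 3) (LocalRing L v)) 0 2) w')) : ℝ≥0) : ℝ) ≤ (((unitModulusChar (LocalRing L v) ϖ : ℝ≥0) : ℝ)⁻¹) ^ n} := by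
  have ha0 : 0 < ((unitModulusChar (LocalRing L v) ϖ : ℝ≥0) : ℝ) := NNReal.coe_pos.2 distribHaarChar_pos
  have ha1 : ((unitModulusChar (LocalRing L v) ϖ : ℝ≥0) : ℝ) < 1 := by exact_mod_cast K2E3SphericalCFunctionShellExpansion.unitModulusChar_uniformizer_lt_one L v hns ϖ hϖ
  have hq : 1 < (((unitModulusChar (LocalRing L v) ϖ : ℝ≥0) : ℝ)⁻¹) := (one_lt_inv_iff₀.2 ⟨ha0, ha1⟩)
  refine Set.ext fun u => ⟨fun hu => ?_, fun hu => ?_⟩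
  · rw [Set.mem_setOf_eq] at hu
    rw [Set.mem_sdiff, Set.mem_setOf_eq, Set.mem_setOf_eq, hu, not_le]
    exact ⟨le_rfl, pow_lt_pow_right₀ hq (Nat.lt_succ_self n)⟩
  · rw [Set.mem_sdiff, Set.mem_setOf_eq, Set.mem_setOf_eq] at hu
    rw [Set.mem_setOf_eq]
    rcases K2E3SphericalCFunctionShellExpansion.height_le_one_or_eq_inv_pow L v hns ϖ hϖ u with h | ⟨m, hm⟩
    · exact absurd (h.trans (one_le_pow₀ hq.le)) hu.2
    · rw [hm] at hu ⊢
      have h1 : n < m + 1 := (pow_lt_pow_iff_right₀ hq).1 (not_le.1 hu.2)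
      have h2 : m + 1 ≤ n + 1 := (pow_le_pow_iff_right₀ hq).1 hu.1
      rw [show m = n by omega]

set_option synthInstance.maxHeartbeats 400000 in
set_option maxHeartbeats 4000000 in
-- the matrix-group carrier of `N(L⁺_v)` (class of ★ `K2E3HeightBallVolumeScaling.measure_heightBall_scaling`)
/-- **THE EVEN-STEP RECURSION OF THE SHELL VOLUMES: `μ(S_{n+3}) = a⁻² · μ(S_{n+1})`** (`v` non-split, `ϖ` a uniformiser unit, `a = ‖ϖ‖ = q_w⁻¹`, `μ` Haar on `N(L⁺_v)`):
`S_{k} = B_{a^{−k}} ∖ B_{a^{−(k−1)}}` with balls of finite measure (★ `measure_heightBall_lt_top`), and both balls scale by `a⁻²` two steps up (`measure_heightBall_succ_succ`);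
Mathlib `measure_sdiff`, `ENNReal.mul_sub`.  (Conjugation by `d(ϖ, 1, ϖ̄⁻¹)` maps `S_k` onto `S_{k+2}` multiplying Haar measure by `δ_B = q_w²`.) [cite: Casselman1995, §6.4 p. 63] [cite: WeilBNT1967, Ch. II §5 Prop. 12] -/
theorem measure_shell_succ_succ (hns : ∀ w : PlacesOver L v, IsCMField.complexConj L • w.1 = w.1)
    (ϖ : (LocalRing L v)ˣ) (hϖ : ∀ w : PlacesOver L v, Valued.v ((ϖ : LocalRing L v) w) = WithZero.exp (-1 : ℤ))
    [MeasurableSpace ↥(cmBorelTriple L 3 v).N] [BorelSpace ↥(cmBorelTriple L 3 v).N] (μ : Measure ↥(cmBorelTriple L 3 v).N) [μ.IsHaarMeasure] (n : ℕ) :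
    μ {u : ↥(cmBorelTriple L 3 v).N | (((∏ w' : PlacesOver L v, normAbs (w'.1.adicCompletion L) ((((((u : ↥(unitaryGroupOfForm (conjLocal L (IsCMField.complexConj L) v) (cmLocalForm L 3 v)))) : GL (Fin 3) (LocalRing L v)) : Matrix (Fin 3) (Fin 3) (LocalRing L v)) 0 2) w')) : ℝ≥0) : ℝ) = (((unitModulusChar (LocalRing L v) ϖ : ℝ≥0) : ℝ)⁻¹) ^ (n + 2 + 1)} =
      (ENNReal.ofNNReal (unitModulusChar (LocalRing L v) ϖ * unitModulusChar (LocalRing L v) ϖ))⁻¹ * μ {u : ↥(cmBorelTriple L 3 v).N | (((∏ w' : PlacesOver L v, normAbs (w'.1.adicCompletion L) ((((((u : ↥(unitaryGroupOfForm (conjLocal L (IsCMField.complexConj L) v) (cmLocalForm L 3 v)))) : GL (Fin 3) (LocalRing L v)) : Matrix (Fin 3) (Fin 3) (LocalRing L v)) 0 2) w')) : ℝ≥0) : ℝ) = (((unitModulusChar (LocalRing L v) ϖ : ℝ≥0) : ℝ)⁻¹) ^ (n + 1)} := by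
  have ha0 : 0 < ((unitModulusChar (LocalRing L v) ϖ : ℝ≥0) : ℝ) := NNReal.coe_pos.2 distribHaarChar_pos
  have ha1 : ((unitModulusChar (LocalRing L v) ϖ : ℝ≥0) : ℝ) < 1 := by exact_mod_cast K2E3SphericalCFunctionShellExpansion.unitModulusChar_uniformizer_lt_one L v hns ϖ hϖ
  have hq : 1 < (((unitModulusChar (LocalRing L v) ϖ : ℝ≥0) : ℝ)⁻¹) := (one_lt_inv_iff₀.2 ⟨ha0, ha1⟩)
  have hm : Measurable fun u : ↥(cmBorelTriple L 3 v).N => (((∏ w' : PlacesOver L v, normAbs (w'.1.adicCompletion L) ((((((u : ↥(unitaryGroupOfForm (conjLocal L (IsCMField.complexConj L) v) (cmLocalForm L 3 v)))) : GL (Fin 3) (LocalRing L v)) : Matrix (Fin 3) (Fin 3) (LocalRing L v)) 0 2) w')) : ℝ≥0) : ℝ) :=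
    (F0P3cStCharTSKeys3AnnulusDock.continuous_norm_entry L v).measurable
  have hsub : ∀ k : ℕ, {u : ↥(cmBorelTriple L 3 v).N | (((∏ w' : PlacesOver L v, normAbs (w'.1.adicCompletion L) ((((((u : ↥(unitaryGroupOfForm (conjLocal L (IsCMField.complexConj L) v) (cmLocalForm L 3 v)))) : GL (Fin 3) (LocalRing L v)) : Matrix (Fin 3) (Fin 3) (LocalRing L v)) 0 2) w')) : ℝ≥0) : ℝ) ≤ (((unitModulusChar (LocalRing L v) ϖ : ℝ≥0) : ℝ)⁻¹) ^ k} ⊆ {u : ↥(cmBorelTriple L 3 v).N | (((∏ w' : PlacesOver L v, normAbs (w'.1.adicCompletion L) ((((((u : ↥(unitaryGroupOfForm (conjLocal L (IsCMField.complexConj L) v) (cmLocalForm L 3 v)))) : GL (Fin 3) (LocalRing L v)) : Matrix (Fin 3) (Fin 3) (LocalRing L v)) 0 2) w')) : ℝ≥0) : ℝ) ≤ (((unitModulusChar (LocalRing L v) ϖ : ℝ≥0) : ℝ)⁻¹) ^ (k + 1)} :=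
    fun k u hu => by
      rw [Set.mem_setOf_eq] at hu ⊢
      exact hu.trans (pow_le_pow_right₀ hq.le (Nat.le_succ k))
  have hfin : ∀ T : ℝ, μ {u : ↥(cmBorelTriple L 3 v).N | (((∏ w' : PlacesOver L v, normAbs (w'.1.adicCompletion L) ((((((u : ↥(unitaryGroupOfForm (conjLocal L (IsCMField.complexConj L) v) (cmLocalForm L 3 v)))) : GL (Fin 3) (LocalRing L v)) : Matrix (Fin 3) (Fin 3) (LocalRing L v)) 0 2) w')) : ℝ≥0) : ℝ) ≤ T} ≠ ∞ :=
    fun T => (K2E3HeightBallVolumeScaling.measure_heightBall_lt_top L v hns μ T).ne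
  have hmeas : ∀ T : ℝ, MeasurableSet {u : ↥(cmBorelTriple L 3 v).N | (((∏ w' : PlacesOver L v, normAbs (w'.1.adicCompletion L) ((((((u : ↥(unitaryGroupOfForm (conjLocal L (IsCMField.complexConj L) v) (cmLocalForm L 3 v)))) : GL (Fin 3) (LocalRing L v)) : Matrix (Fin 3) (Fin 3) (LocalRing L v)) 0 2) w')) : ℝ≥0) : ℝ) ≤ T} := fun T => measurableSet_le hm measurable_const
  have hc : (ENNReal.ofNNReal (unitModulusChar (LocalRing L v) ϖ * unitModulusChar (LocalRing L v) ϖ))⁻¹ ≠ ∞ :=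
    ENNReal.inv_ne_top.2 (ENNReal.coe_ne_zero.2 (mul_ne_zero distribHaarChar_pos.ne' distribHaarChar_pos.ne'))
  rw [shell_eq_ball_diff L v hns ϖ hϖ (n + 2), shell_eq_ball_diff L v hns ϖ hϖ n,
    measure_sdiff (hsub (n + 2)) (hmeas _).nullMeasurableSet (hfin _), measure_sdiff (hsub n) (hmeas _).nullMeasurableSet (hfin _),
    show n + 2 + 1 = (n + 1) + 2 by ring, measure_heightBall_succ_succ L v ϖ μ (n + 1), measure_heightBall_succ_succ L v ϖ μ n,
    ENNReal.mul_sub (fun _ _ => hc)]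

set_option synthInstance.maxHeartbeats 400000 in
set_option maxHeartbeats 4000000 in
-- the matrix-group carrier of `N(L⁺_v)` (class of ★ `K2E3HeightBallVolumeScaling.measure_heightBall_scaling`)
/-- **`μ.real(S_{n+3}) = a⁻² · μ.real(S_{n+1})`** — the real-valued form of `measure_shell_succ_succ` (`ENNReal.toReal`). [cite: Casselman1995, §6.4 p. 63] [cite: WeilBNT1967, Ch. II §5 Prop. 12] -/
theorem measureReal_shell_succ_succ (hns : ∀ w : PlacesOver L v, IsCMField.complexConj L • w.1 = w.1)
    (ϖ : (LocalRing L v)ˣ) (hϖ : ∀ w : PlacesOver L v, Valued.v ((ϖ : LocalRing L v) w) = WithZero.exp (-1 : ℤ))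
    [MeasurableSpace ↥(cmBorelTriple L 3 v).N] [BorelSpace ↥(cmBorelTriple L 3 v).N] (μ : Measure ↥(cmBorelTriple L 3 v).N) [μ.IsHaarMeasure] (n : ℕ) :
    μ.real {u : ↥(cmBorelTriple L 3 v).N | (((∏ w' : PlacesOver L v, normAbs (w'.1.adicCompletion L) ((((((u : ↥(unitaryGroupOfForm (conjLocal L (IsCMField.complexConj L) v) (cmLocalForm L 3 v)))) : GL (Fin 3) (LocalRing L v)) : Matrix (Fin 3) (Fin 3) (LocalRing L v)) 0 2) w')) : ℝ≥0) : ℝ) = (((unitModulusChar (LocalRing L v) ϖ : ℝ≥0) : ℝ)⁻¹) ^ (n + 2 + 1)} =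
      (((unitModulusChar (LocalRing L v) ϖ : ℝ≥0) : ℝ) * ((unitModulusChar (LocalRing L v) ϖ : ℝ≥0) : ℝ))⁻¹ * μ.real {u : ↥(cmBorelTriple L 3 v).N | (((∏ w' : PlacesOver L v, normAbs (w'.1.adicCompletion L) ((((((u : ↥(unitaryGroupOfForm (conjLocal L (IsCMField.complexConj L) v) (cmLocalForm L 3 v)))) : GL (Fin 3) (LocalRing L v)) : Matrix (Fin 3) (Fin 3) (LocalRing L v)) 0 2) w')) : ℝ≥0) : ℝ) = (((unitModulusChar (LocalRing L v) ϖ : ℝ≥0) : ℝ)⁻¹) ^ (n + 1)} := by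
  rw [measureReal_def, measureReal_def, measure_shell_succ_succ L v hns ϖ hϖ μ n, ENNReal.toReal_mul, ENNReal.toReal_inv, ENNReal.coe_toReal,
    NNReal.coe_mul]

/-! ## §3 The shell series is a two-step geometric series of ratio `z²` -/

set_option synthInstance.maxHeartbeats 400000 in
set_option maxHeartbeats 4000000 in
-- the matrix-group carrier of `N(L⁺_v)` (class of ★ `K2E3SphericalCFunctionShellExpansion.hasSum_shell_integrals`)
/-- **THE SHELL SERIES SUMMED.**  `v` non-split, `ϖ` a uniformiser unit, `a = ‖ϖ‖`, `μ` Haar on `N(L⁺_v)`, `z = χ₁(ϖ)` with `|z| < 1`, `c₂ = χ₂(−1)`, `f₁ ∈ ℂ`.  The series of ★ p855911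
`Σ'_n μ(S_{n+1}) · (z^{n+1} c₂ a^{n+1}) · f₁` satisfies `term_{n+2} = z² · term_n` (§2: `μ(S_{n+3}) = a⁻² μ(S_{n+1})`), hence (§1) equals
**`(μ(S₁) · (z c₂ a) · f₁ + μ(S₂) · (z² c₂ a²) · f₁) · (1 − z²)⁻¹`**. [cite: Casselman1995, §6.4 p. 63] [cite: Rogawski1990, §4.5 p. 45] [cite: TateThesis1967, §2.4] -/
theorem tsum_shellSeries_eq (hns : ∀ w : PlacesOver L v, IsCMField.complexConj L • w.1 = w.1)
    (χ₁ : (LocalRing L v)ˣ →* ℂˣ) (χ₂ : ↥(normOneUnits (conjLocal L (IsCMField.complexConj L) v)) →* ℂˣ)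
    (ϖ : (LocalRing L v)ˣ) (hϖ : ∀ w : PlacesOver L v, Valued.v ((ϖ : LocalRing L v) w) = WithZero.exp (-1 : ℤ))
    [MeasurableSpace ↥(cmBorelTriple L 3 v).N] [BorelSpace ↥(cmBorelTriple L 3 v).N] (μ : Measure ↥(cmBorelTriple L 3 v).N) [μ.IsHaarMeasure] (hz : ‖((χ₁ ϖ : ℂˣ) : ℂ)‖ < 1) (f₁ : ℂ) :
    ∑' n : ℕ, (μ.real {u : ↥(cmBorelTriple L 3 v).N | (((∏ w' : PlacesOver L v, normAbs (w'.1.adicCompletion L) ((((((u : ↥(unitaryGroupOfForm (conjLocal L (IsCMField.complexConj L) v) (cmLocalForm L 3 v)))) : GL (Fin 3) (LocalRing L v)) : Matrix (Fin 3) (Fin 3) (LocalRing L v)) 0 2) w')) : ℝ≥0) : ℝ) = (((unitModulusChar (LocalRing L v) ϖ : ℝ≥0) : ℝ)⁻¹) ^ (n + 1)} : ℂ) *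
        ((((χ₁ ϖ : ℂˣ) : ℂ) ^ (n + 1) * ((χ₂ ⟨-1, F0P3cStCharTSBigCellFactorisation.neg_one_mem_normOneUnits (conjLocal L (IsCMField.complexConj L) v)⟩ : ℂˣ) : ℂ) *
          (((unitModulusChar (LocalRing L v) ϖ : ℝ≥0) : ℝ) : ℂ) ^ (n + 1)) * f₁) =
      ((μ.real {u : ↥(cmBorelTriple L 3 v).N | (((∏ w' : PlacesOver L v, normAbs (w'.1.adicCompletion L) ((((((u : ↥(unitaryGroupOfForm (conjLocal L (IsCMField.complexConj L) v) (cmLocalForm L 3 v)))) : GL (Fin 3) (LocalRing L v)) : Matrix (Fin 3) (Fin 3) (LocalRing L v)) 0 2) w')) : ℝ≥0) : ℝ) = (((unitModulusChar (LocalRing L v) ϖ : ℝ≥0) : ℝ)⁻¹) ^ 1} : ℂ) * (((χ₁ ϖ : ℂˣ) : ℂ) * ((χ₂ ⟨-1, F0P3cStCharTSBigCellFactorisation.neg_one_mem_normOneUnits (conjLocal L (IsCMField.complexConj L) v)⟩ : ℂˣ) : ℂ) * (((unitModulusChar (LocalRing L v) ϖ : ℝ≥0) : ℝ) : ℂ))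 * f₁ +
        (μ.real {u : ↥(cmBorelTriple L 3 v).N | (((∏ w' : PlacesOver L v, normAbs (w'.1.adicCompletion L) ((((((u : ↥(unitaryGroupOfForm (conjLocal L (IsCMField.complexConj L) v) (cmLocalForm L 3 v)))) : GL (Fin 3) (LocalRing L v)) : Matrix (Fin 3) (Fin 3) (LocalRing L v)) 0 2) w')) : ℝ≥0) : ℝ) = (((unitModulusChar (LocalRing L v) ϖ : ℝ≥0) : ℝ)⁻¹) ^ 2} : ℂ) * (((χ₁ ϖ : ℂˣ) : ℂ) ^ 2 * ((χ₂ ⟨-1, F0P3cStCharTSBigCellFactorisation.neg_one_mem_normOneUnits (conjLocal L (IsCMField.complexConj L) v)⟩ : ℂˣ) : ℂ) * (((unitModulusChar (LocalRing L v) ϖ : ℝ≥0) : ℝ) : ℂ) ^ 2) * f₁) *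
        (1 - ((χ₁ ϖ : ℂˣ) : ℂ) ^ 2)⁻¹ := by
  have ha0 : (((unitModulusChar (LocalRing L v) ϖ : ℝ≥0) : ℝ) : ℂ) ≠ 0 := by exact_mod_cast (NNReal.coe_pos.2 (distribHaarChar_pos (g := ϖ))).ne'
  have hr : ‖((χ₁ ϖ : ℂˣ) : ℂ) ^ 2‖ < 1 := by rw [norm_pow]; exact pow_lt_one₀ (norm_nonneg _) hz two_ne_zero
  have hrec : ∀ n : ℕ, (μ.real {u : ↥(cmBorelTriple L 3 v).N | (((∏ w' : PlacesOver L v, normAbs (w'.1.adicCompletion L) ((((((u : ↥(unitaryGroupOfForm (conjLocal L (IsCMField.complexConj L) v) (cmLocalForm L 3 v)))) : GL (Fin 3) (LocalRing L v)) : Matrix (Fin 3) (Fin 3) (LocalRing L v)) 0 2) w')) : ℝ≥0) : ℝ) = (((unitModulusChar (LocalRing L v) ϖ : ℝ≥0) : ℝ)⁻¹) ^ (n + 2 + 1)} : ℂ) *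
        ((((χ₁ ϖ : ℂˣ) : ℂ) ^ (n + 2 + 1) * ((χ₂ ⟨-1, F0P3cStCharTSBigCellFactorisation.neg_one_mem_normOneUnits (conjLocal L (IsCMField.complexConj L) v)⟩ : ℂˣ) : ℂ) *
          (((unitModulusChar (LocalRing L v) ϖ : ℝ≥0) : ℝ) : ℂ) ^ (n + 2 + 1)) * f₁) =
      ((χ₁ ϖ : ℂˣ) : ℂ) ^ 2 * ((μ.real {u : ↥(cmBorelTriple L 3 v).N | (((∏ w' : PlacesOver L v, normAbs (w'.1.adicCompletion L) ((((((u : ↥(unitaryGroupOfForm (conjLocal L (IsCMField.complexConj L) v) (cmLocalForm L 3 v)))) : GL (Fin 3) (LocalRing L v)) : Matrix (Fin 3) (Fin 3) (LocalRing L v)) 0 2) w')) : ℝ≥0) : ℝ) = (((unitModulusChar (LocalRing L v) ϖ : ℝ≥0) : ℝ)⁻¹) ^ (n + 1)} : ℂ) *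
        ((((χ₁ ϖ : ℂˣ) : ℂ) ^ (n + 1) * ((χ₂ ⟨-1, F0P3cStCharTSBigCellFactorisation.neg_one_mem_normOneUnits (conjLocal L (IsCMField.complexConj L) v)⟩ : ℂˣ) : ℂ) *
          (((unitModulusChar (LocalRing L v) ϖ : ℝ≥0) : ℝ) : ℂ) ^ (n + 1)) * f₁)) := fun n => by
    rw [measureReal_shell_succ_succ L v hns ϖ hϖ μ n]
    push_cast
    field_simp
    ring
  rw [tsum_eq_of_succ_succ_eq_mul (a := fun n : ℕ => (μ.real {u : ↥(cmBorelTriple L 3 v).N | (((∏ w' : PlacesOver L v, normAbs (w'.1.adicCompletion L) ((((((u : ↥(unitaryGroupOfForm (conjLocal L (IsCMField.complexConj L) v) (cmLocalForm L 3 v)))) : GL (Fin 3) (LocalRing L v)) : Matrix (Fin 3) (Fin 3) (LocalRing L v)) 0 2) w')) : ℝ≥0) : ℝ) = (((unitModulusChar (LocalRing L v) ϖ : ℝ≥0) : ℝ)⁻¹) ^ (n + 1)} : ℂ) *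
    ((((χ₁ ϖ : ℂˣ) : ℂ) ^ (n + 1) * ((χ₂ ⟨-1, F0P3cStCharTSBigCellFactorisation.neg_one_mem_normOneUnits (conjLocal L (IsCMField.complexConj L) v)⟩ : ℂˣ) : ℂ) *
      (((unitModulusChar (LocalRing L v) ϖ : ℝ≥0) : ℝ) : ℂ) ^ (n + 1)) * f₁)) hr hrec]
  simp only [zero_add, one_add_one_eq_two, pow_one]
  ring

/-! ## §4 The closed form of `∫_N f(w₀ u) dμ` -/

set_option synthInstance.maxHeartbeats 400000 in
set_option maxHeartbeats 8000000 in
-- statement∕proof over the `SmoothInd` carrier of ★ `cmPrincipalSeries` (class of ★ `K2E3SphericalCFunctionShellExpansion.integral_cellFun_eq_shellExpansion_of_modulus`)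
/-- **THE CLOSED FORM OF HARISH-CHANDRA'S `c`-FUNCTION INTEGRAL.**  `v` non-split, `w₀` of matrix `Φ₃`, `μ` a Haar measure of `N(L⁺_v)`, `ϖ` a uniformiser unit (`a = ‖ϖ‖ = q_w⁻¹`), `χ₂` continuous,
`χ₁` UNRAMIFIED with `|χ₁(x)| = ‖x‖^s` for all `x` and `s > 0` (so `z = χ₁(ϖ)` has `|z| = a^s < 1`), `f` a `K_v`-fixed vector of ★ `cmPrincipalSeries L 3 v (χ₁, χ₂)`.  Then
**`∫_N f(w₀ u) dμ = (μ(B₁) + χ₂(−1)·(μ(S₁)·(z a) + μ(S₂)·(z a)²)·(1 − z²)⁻¹) · f(1)`**, `B₁ = {m ≤ 1}`, `S_k = {m = a^{−k}}` — ★ `integral_cellFun_eq_shellExpansion_of_modulus` summed by §3.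
The two ratios `μ(S₁)∕μ(B₁)`, `μ(S₂)∕μ(B₁)` (by ramification type of `v` in `L`) are all that separates this from Macdonald's explicit formula. [cite: Casselman1995, §6.4 pp. 62–64] [cite: Rogawski1990, §4.5 p. 45] [cite: Keys1984, §4] -/
theorem integral_cellFun_eq_closedForm (hns : ∀ w : PlacesOver L v, IsCMField.complexConj L • w.1 = w.1)
    (χ₁ : (LocalRing L v)ˣ →* ℂˣ) (χ₂ : ↥(normOneUnits (conjLocal L (IsCMField.complexConj L) v)) →* ℂˣ)
    (h₂ : Continuous fun x => ((χ₂ x : ℂˣ) : ℂ))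
    (hunr : ∀ u ∈ (Submonoid.pi Set.univ (fun w : PlacesOver L v => (w.1.adicCompletionIntegers L).toSubring.toSubmonoid)).units, χ₁ u = 1) {s : ℝ} (hs : 0 < s)
    (hχ₁ : ∀ x : (LocalRing L v)ˣ, ‖((χ₁ x : ℂˣ) : ℂ)‖ = ((unitModulusChar (LocalRing L v) x : ℝ≥0) : ℝ) ^ s)
    (ϖ : (LocalRing L v)ˣ) (hϖ : ∀ w : PlacesOver L v, Valued.v ((ϖ : LocalRing L v) w) = WithZero.exp (-1 : ℤ))
    (w₀ : ↥(unitaryGroupOfForm (conjLocal L (IsCMField.complexConj L) v) (cmLocalForm L 3 v))) (hw₀ : Units.val (w₀ : GL (Fin 3) (LocalRing L v)) = cmLocalForm L 3 v)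
    [MeasurableSpace ↥(cmBorelTriple L 3 v).N] [BorelSpace ↥(cmBorelTriple L 3 v).N] (μ : Measure ↥(cmBorelTriple L 3 v).N) [μ.IsHaarMeasure]
    (f : haveI := locallyCompactSpace_cmBorelU L 3 v
      Representation.SmoothInd (cmBorelTriple L 3 v).P (Representation.twist (((Representation.trivial ℂ ↥(torusU (conjLocal L (IsCMField.complexConj L) v) (cmLocalForm L 3 v)) ℂ).twist
        (cmTorusCharPair L v χ₁ χ₂)).comp (cmBorelTriple L 3 v).proj) (rootDeltaChar (cmBorelTriple L 3 v).P)))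
    (hf : haveI := locallyCompactSpace_cmBorelU L 3 v
      f ∈ (Representation.smoothIndRep (cmBorelTriple L 3 v).P _).fixedPoints (cmLocalIntegralLevel L 3 (Matrix.of fun i j : Fin 3 => if i.val + j.val + 1 = 3 then (1 : L) else 0) v)) :
    ∫ u : ↥(cmBorelTriple L 3 v).N, f.toFun (w₀ * (u : ↥(unitaryGroupOfForm (conjLocal L (IsCMField.complexConj L) v) (cmLocalForm L 3 v)))) ∂μ =
      ((μ.real {u : ↥(cmBorelTriple L 3 v).N | (((∏ w' : PlacesOver L v, normAbs (w'.1.adicCompletion L) ((((((u : ↥(unitaryGroupOfForm (conjLocal L (IsCMField.complexConj L) v) (cmLocalForm L 3 v)))) : GL (Fin 3) (LocalRing L v)) : Matrix (Fin 3) (Fin 3) (LocalRing L v)) 0 2) w')) : ℝ≥0) : ℝ) ≤ 1} : ℂ) +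
        ((χ₂ ⟨-1, F0P3cStCharTSBigCellFactorisation.neg_one_mem_normOneUnits (conjLocal L (IsCMField.complexConj L) v)⟩ : ℂˣ) : ℂ) *
          ((μ.real {u : ↥(cmBorelTriple L 3 v).N | (((∏ w' : PlacesOver L v, normAbs (w'.1.adicCompletion L) ((((((u : ↥(unitaryGroupOfForm (conjLocal L (IsCMField.complexConj L) v) (cmLocalForm L 3 v)))) : GL (Fin 3) (LocalRing L v)) : Matrix (Fin 3) (Fin 3) (LocalRing L v)) 0 2) w')) : ℝ≥0) : ℝ) = (((unitModulusChar (LocalRing L v) ϖ : ℝ≥0) : ℝ)⁻¹) ^ 1} : ℂ) * (((χ₁ ϖ : ℂˣ) : ℂ) * (((unitModulusChar (LocalRing L v) ϖ : ℝ≥0) : ℝ) : ℂ)) +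
            (μ.real {u : ↥(cmBorelTriple L 3 v).N | (((∏ w' : PlacesOver L v, normAbs (w'.1.adicCompletion L) ((((((u : ↥(unitaryGroupOfForm (conjLocal L (IsCMField.complexConj L) v) (cmLocalForm L 3 v)))) : GL (Fin 3) (LocalRing L v)) : Matrix (Fin 3) (Fin 3) (LocalRing L v)) 0 2) w')) : ℝ≥0) : ℝ) = (((unitModulusChar (LocalRing L v) ϖ : ℝ≥0) : ℝ)⁻¹) ^ 2} : ℂ) * (((χ₁ ϖ : ℂˣ) : ℂ) * (((unitModulusChar (LocalRing L v) ϖ : ℝ≥0) : ℝ) : ℂ)) ^ 2) *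
          (1 - ((χ₁ ϖ : ℂˣ) : ℂ) ^ 2)⁻¹) * f.toFun 1 := by
  have ha0 : 0 < ((unitModulusChar (LocalRing L v) ϖ : ℝ≥0) : ℝ) := NNReal.coe_pos.2 distribHaarChar_pos
  have ha1 : ((unitModulusChar (LocalRing L v) ϖ : ℝ≥0) : ℝ) < 1 := by exact_mod_cast K2E3SphericalCFunctionShellExpansion.unitModulusChar_uniformizer_lt_one L v hns ϖ hϖ
  have hz : ‖((χ₁ ϖ : ℂˣ) : ℂ)‖ < 1 := by rw [hχ₁ ϖ]; exact Real.rpow_lt_one ha0.le ha1 hs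
  rw [K2E3SphericalCFunctionShellExpansion.integral_cellFun_eq_shellExpansion_of_modulus L v hns χ₁ χ₂ h₂ hunr hs hχ₁ ϖ hϖ w₀ hw₀ μ f hf,
    tsum_shellSeries_eq L v hns χ₁ χ₂ ϖ hϖ μ hz (f.toFun 1)]
  ring

/-! ## §5 Harish-Chandra's `c`-function in closed form: `J(w, χ) f_K = (μ(B₁) + χ₂(−1)(V₁ z a + V₂ z² a²)∕(1 − z²)) f_K(1) • f'_K` -/

set_option synthInstance.maxHeartbeats 400000 in
set_option maxHeartbeats 8000000 in
-- statement∕proof over two `SmoothInd` carriers of ★ `cmPrincipalSeries` (class of ★ `K2E3SphericalCFunctionShellExpansion.exists_intertwiningIntegral_sphericalVector_eq_shellExpansion_smul`)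
/-- **HARISH-CHANDRA'S `c`-FUNCTION IN CLOSED FORM** (docked on ★ I-2a).  `v` NON-SPLIT, `w₀` of matrix `Φ₃`, `μ` a Haar measure of `N(L⁺_v)`, `ϖ` a uniformiser unit, `a = ‖ϖ‖ = q_w⁻¹`,
`χ₁, χ₂` continuous, `χ₁` UNRAMIFIED with `|χ₁| = ‖·‖^s`, `s > 0`, `z = χ₁(ϖ)`; `f_K ∈ i_G(χ)^{K_v}`, `f'_K ∈ i_G(wχ)^{K_v}` with `f'_K(1) = 1`.  Then the intertwining integral `J` of ★
RUNG 3 (`J ≠ 0`, `(J f)(g) = ∫_N f(w₀ n g) dμ`) satisfies **`J f_K = ((μ(B₁) + χ₂(−1)·(μ(S₁)·(z a) + μ(S₂)·(z a)²)·(1 − z²)⁻¹) · f_K(1)) • f'_K`** — i.e. with `f_K(1) = 1`,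
`χ₂ = 1`, `t = z∕q_w`, `V_k = μ(S_k)`: **`c_w(χ) = μ(B₁) + (V₁ t + V₂ t²)∕(1 − z²)`**, a rational function of `z` whose only candidate poles on the unramified line sit at `z² = 1`
(`wχ = χ`).  ★ p855911 §5 + §3. [cite: Casselman1995, §6.4 pp. 62–64] [cite: Rogawski1990, §4.5 p. 45; §12.2 p. 173] [cite: Keys1984, §3–§4] -/
theorem exists_intertwiningIntegral_sphericalVector_eq_closedForm_smul (hns : ∀ w : PlacesOver L v, IsCMField.complexConj L • w.1 = w.1)
    (χ₁ : (LocalRing L v)ˣ →* ℂˣ) (χ₂ : ↥(normOneUnits (conjLocal L (IsCMField.complexConj L) v)) →* ℂˣ)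
    (h₁ : Continuous fun x => ((χ₁ x : ℂˣ) : ℂ)) (h₂ : Continuous fun x => ((χ₂ x : ℂˣ) : ℂ))
    (hunr : ∀ u ∈ (Submonoid.pi Set.univ (fun w : PlacesOver L v => (w.1.adicCompletionIntegers L).toSubring.toSubmonoid)).units, χ₁ u = 1) {s : ℝ} (hs : 0 < s)
    (hχ₁ : ∀ x : (LocalRing L v)ˣ, ‖((χ₁ x : ℂˣ) : ℂ)‖ = ((unitModulusChar (LocalRing L v) x : ℝ≥0) : ℝ) ^ s)
    (ϖ : (LocalRing L v)ˣ) (hϖ : ∀ w : PlacesOver L v, Valued.v ((ϖ : LocalRing L v) w) = WithZero.exp (-1 : ℤ))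
    (w₀ : ↥(unitaryGroupOfForm (conjLocal L (IsCMField.complexConj L) v) (cmLocalForm L 3 v))) (hw₀ : Units.val (w₀ : GL (Fin 3) (LocalRing L v)) = cmLocalForm L 3 v)
    [MeasurableSpace ↥(cmBorelTriple L 3 v).N] [BorelSpace ↥(cmBorelTriple L 3 v).N] (μ : Measure ↥(cmBorelTriple L 3 v).N) [μ.IsHaarMeasure]
    (fK : haveI := locallyCompactSpace_cmBorelU L 3 v
      Representation.SmoothInd (cmBorelTriple L 3 v).P (Representation.twist (((Representation.trivial ℂ ↥(torusU (conjLocal L (IsCMField.complexConj L) v) (cmLocalForm L 3 v)) ℂ).twist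
        (cmTorusCharPair L v χ₁ χ₂)).comp (cmBorelTriple L 3 v).proj) (rootDeltaChar (cmBorelTriple L 3 v).P)))
    (hfK : haveI := locallyCompactSpace_cmBorelU L 3 v
      fK ∈ (Representation.smoothIndRep (cmBorelTriple L 3 v).P _).fixedPoints (cmLocalIntegralLevel L 3 (Matrix.of fun i j : Fin 3 => if i.val + j.val + 1 = 3 then (1 : L) else 0) v))
    (fK' : haveI := locallyCompactSpace_cmBorelU L 3 v
      Representation.SmoothInd (cmBorelTriple L 3 v).P (Representation.twist (((Representation.trivial ℂ ↥(torusU (conjLocal L (IsCMField.complexConj L) v) (cmLocalForm L 3 v)) ℂ).twist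
        (cmTorusCharPair L v (conjInvChar (conjLocal L (IsCMField.complexConj L) v) χ₁) χ₂)).comp (cmBorelTriple L 3 v).proj) (rootDeltaChar (cmBorelTriple L 3 v).P)))
    (hfK' : haveI := locallyCompactSpace_cmBorelU L 3 v
      fK' ∈ (Representation.smoothIndRep (cmBorelTriple L 3 v).P _).fixedPoints (cmLocalIntegralLevel L 3 (Matrix.of fun i j : Fin 3 => if i.val + j.val + 1 = 3 then (1 : L) else 0) v))
    (h1 : fK'.toFun 1 = 1) :
    ∃ J : (cmPrincipalSeries L 3 v (cmTorusCharPair L v χ₁ χ₂)).IntertwiningMap (cmPrincipalSeries L 3 v (cmTorusCharPair L v (conjInvChar (conjLocal L (IsCMField.complexConj L) v) χ₁) χ₂)),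
      J ≠ 0 ∧
      (∀ (f : haveI := locallyCompactSpace_cmBorelU L 3 v
      Representation.SmoothInd (cmBorelTriple L 3 v).P (Representation.twist (((Representation.trivial ℂ ↥(torusU (conjLocal L (IsCMField.complexConj L) v) (cmLocalForm L 3 v)) ℂ).twist
        (cmTorusCharPair L v χ₁ χ₂)).comp (cmBorelTriple L 3 v).proj) (rootDeltaChar (cmBorelTriple L 3 v).P)))
        (g : ↥(unitaryGroupOfForm (conjLocal L (IsCMField.complexConj L) v) (cmLocalForm L 3 v))),
        (J f).toFun g = ∫ n : ↥(cmBorelTriple L 3 v).N, f.toFun (w₀ * (n : ↥(unitaryGroupOfForm (conjLocal L (IsCMField.complexConj L) v) (cmLocalForm L 3 v))) * g) ∂μ) ∧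
      J fK = (((μ.real {u : ↥(cmBorelTriple L 3 v).N | (((∏ w' : PlacesOver L v, normAbs (w'.1.adicCompletion L) ((((((u : ↥(unitaryGroupOfForm (conjLocal L (IsCMField.complexConj L) v) (cmLocalForm L 3 v)))) : GL (Fin 3) (LocalRing L v)) : Matrix (Fin 3) (Fin 3) (LocalRing L v)) 0 2) w')) : ℝ≥0) : ℝ) ≤ 1} : ℂ) +
        ((χ₂ ⟨-1, F0P3cStCharTSBigCellFactorisation.neg_one_mem_normOneUnits (conjLocal L (IsCMField.complexConj L) v)⟩ : ℂˣ) : ℂ) *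
          ((μ.real {u : ↥(cmBorelTriple L 3 v).N | (((∏ w' : PlacesOver L v, normAbs (w'.1.adicCompletion L) ((((((u : ↥(unitaryGroupOfForm (conjLocal L (IsCMField.complexConj L) v) (cmLocalForm L 3 v)))) : GL (Fin 3) (LocalRing L v)) : Matrix (Fin 3) (Fin 3) (LocalRing L v)) 0 2) w')) : ℝ≥0) : ℝ) = (((unitModulusChar (LocalRing L v) ϖ : ℝ≥0) : ℝ)⁻¹) ^ 1} : ℂ) * (((χ₁ ϖ : ℂˣ) : ℂ) * (((unitModulusChar (LocalRing L v) ϖ : ℝ≥0) : ℝ) : ℂ)) +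
            (μ.real {u : ↥(cmBorelTriple L 3 v).N | (((∏ w' : PlacesOver L v, normAbs (w'.1.adicCompletion L) ((((((u : ↥(unitaryGroupOfForm (conjLocal L (IsCMField.complexConj L) v) (cmLocalForm L 3 v)))) : GL (Fin 3) (LocalRing L v)) : Matrix (Fin 3) (Fin 3) (LocalRing L v)) 0 2) w')) : ℝ≥0) : ℝ) = (((unitModulusChar (LocalRing L v) ϖ : ℝ≥0) : ℝ)⁻¹) ^ 2} : ℂ) * (((χ₁ ϖ : ℂˣ) : ℂ) * (((unitModulusChar (LocalRing L v) ϖ : ℝ≥0) : ℝ) : ℂ)) ^ 2) *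
          (1 - ((χ₁ ϖ : ℂˣ) : ℂ) ^ 2)⁻¹) * fK.toFun 1) • fK' := by
  have ha0 : 0 < ((unitModulusChar (LocalRing L v) ϖ : ℝ≥0) : ℝ) := NNReal.coe_pos.2 distribHaarChar_pos
  have ha1 : ((unitModulusChar (LocalRing L v) ϖ : ℝ≥0) : ℝ) < 1 := by exact_mod_cast K2E3SphericalCFunctionShellExpansion.unitModulusChar_uniformizer_lt_one L v hns ϖ hϖ
  have hz : ‖((χ₁ ϖ : ℂˣ) : ℂ)‖ < 1 := by rw [hχ₁ ϖ]; exact Real.rpow_lt_one ha0.le ha1 hs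
  obtain ⟨J, hJ, hJint, hJK⟩ := K2E3SphericalCFunctionShellExpansion.exists_intertwiningIntegral_sphericalVector_eq_shellExpansion_smul L v hns χ₁ χ₂ h₁ h₂ hunr hs hχ₁
    ϖ hϖ w₀ hw₀ μ fK hfK fK' hfK' h1
  refine ⟨J, hJ, hJint, ?_⟩
  rw [hJK, tsum_shellSeries_eq L v hns χ₁ χ₂ ϖ hϖ μ hz (fK.toFun 1)]
  congr 1
  ring

end Summit.HodgeConjecture.HodgeConjecture.Cruxes.H413.K2E3SphericalCFunctionClosedForm

end
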